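import Mathlib
import HarnessLib
import Summits.RiemannHypothesis.RiemannHypothesis.Theorems.IntegerScrewWalkStates
import Summits.RiemannHypothesis.RiemannHypothesis.Theorems.IntegerScrewBracketBounds
import Summits.RiemannHypothesis.RiemannHypothesis.Theorems.IntegerScrewMertensAbel

/-!
# Route `IntegerScrew` — 16.5 (a) for the walk: the `E_Mert` term of the exact decomposition 16.4 is `O(K/L)`,
# UNCONDITIONALLY (`−8K(u,ρ) ≤ L·E_Mert ≤ 16K(u,ρ)`)

CONTINUUM-LIMIT 16.4 writes `(𝒜_D − ∂_u)h̃ = Π·[E_Mert − C_px + B₂ + B_rep]` with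

  `E_Mert = (1/L)·Σ_{q ≤ M/x prime} (log q/q)·F(θ_q) − ∫₀^ρ F(θ)dθ`, `F(θ) = K(u,ρ−θ)(1 − e^{−uθ}) − K(u,ρ)`,

`ρ = ρ_x = 1 − log x/L`, `L = log M`, and 16.5 (a) bounds `E_Mert` by Abel summation against Mertens' first theorem.
This file is that step IN THE KERNEL, assembled from

* `IntegerScrewMertensAbel` — the abstract Mertens–Abel bound with the tree's PROVED `−4 ≤ ϑ₁(t) − log t ≤ 0`
  (Hardy–Wright Thm 425 as `MertensBound.sum_log_div_prime_bounds`; Rosser–Schoenfeld (3.24) as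
  `RosserSchoenfeld1962_eq_3_24_holds`), so NO named hypothesis enters;
* `IntegerScrewHarmonicK` — `∫₀^ρ F = I(u,ρ)` ((H2), `integral_ccpK_shift_eq_ccpI`);
* `IntegerScrewBracketBounds` / `IntegerScrewHarmonicKappa` — `|F(ρ)| ≤ K(u,0) ≤ 2K(u,ρ)`, `F(ρ) − F(0) ≤ K(u,0)`;
* here: `F` is `C¹` in `θ` with `F′(θ) = u|c|e^{−u(ρ−θ)}(1 − e^{−uθ}) + uK(u,ρ−θ)e^{−uθ} ≥ 0` on `θ ≥ 0`.

RESULT (`theorem prime_sum_bracketF_sub_integral_bounds`): for `2 ≤ M`, `1 ≤ x ≤ M`, `u > 0`, `L = log M`, `ρ = room L x`: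

  `−8·K(u,ρ) ≤ Σ_{q ≤ M/x prime} (log q/q)·F(log q/L) − L·I(u,ρ) ≤ 16·K(u,ρ)`,

i.e. `−8K/L ≤ E_Mert ≤ 16K/L` — CONTINUUM-LIMIT 16.5 (a) with `(E₂, κ₀) = (4, 2)` in place of `(1.84, 1.4254)`
(printed: `−2.62K/L ≤ E_Mert ≤ 5.25K/L`), unconditionally.  RH-free; nothing here bears on the truth of RH.
References: CONTINUUM-LIMIT §16.4–16.5, §23.11; PIVOT-LAW 13.44/13.50/13.52; M. Suzuki, J. Lond. Math. Soc. (2) 108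
(2023) 1448–1487 [Suzuki2023].
-/

noncomputable section

-- D-0017: `Summit.<S>.<S>.…` is the designed namespace of a single-problem summit.
set_option linter.dupNamespace false

namespace Summit.RiemannHypothesis.RiemannHypothesis.Theorems.IntegerScrew

open Real

/-! ## `F(θ) = K(u,ρ−θ)(1 − e^{−uθ}) − K(u,ρ)` is `C¹` in `θ` with a non-negative derivative on `θ ≥ 0` -/

/-- `d/dθ F(θ) = u|c(u)|e^{−u(ρ−θ)}(1 − e^{−uθ}) + u·K(u,ρ−θ)·e^{−uθ}` (with `|c| = −c`; `u ≠ 0`). -/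
theorem hasDerivAt_bracketF {u : ℝ} (hu : u ≠ 0) (ρ θ : ℝ) :
    HasDerivAt (fun t : ℝ => ccpK u (ρ - t) * (1 - exp (-(u * t))) - ccpK u ρ)
      (u * (-ccpc u) * exp (-(u * (ρ - θ))) * (1 - exp (-(u * θ)))
        + ccpK u (ρ - θ) * (u * exp (-(u * θ)))) θ := by
  have e : (fun t : ℝ => ccpK u (ρ - t) * (1 - exp (-(u * t))) - ccpK u ρ) =
      fun t : ℝ => (ccpA u - ccpc u * exp (-(u * (ρ - t)))) * (1 - exp (-(u * t))) - ccpK u ρ := by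
    funext t; rw [ccpK_eq_ccpA_sub hu]
  rw [e]
  have h1 : HasDerivAt (fun t : ℝ => -(u * (ρ - t))) u θ :=
    (((hasDerivAt_id' θ).const_sub ρ).const_mul u).fun_neg.congr_deriv (by ring)
  have h2 : HasDerivAt (fun t : ℝ => -(u * t)) (-u) θ :=
    ((hasDerivAt_id' θ).const_mul u).fun_neg.congr_deriv (by ring)
  have hK : HasDerivAt (fun t : ℝ => ccpA u - ccpc u * exp (-(u * (ρ - t))))
      (-(ccpc u * (exp (-(u * (ρ - θ))) * u))) θ := (h1.exp.const_mul (ccpc u)).const_sub (ccpA u)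
  have hφ : HasDerivAt (fun t : ℝ => 1 - exp (-(u * t))) (-(exp (-(u * θ)) * -u)) θ := h2.exp.const_sub 1
  refine ((hK.fun_mul hφ).sub_const (ccpK u ρ)).congr_deriv ?_
  rw [ccpK_eq_ccpA_sub hu]
  ring

/-- The derivative of `F` is continuous in `θ`. -/
theorem continuous_bracketF_deriv (u ρ : ℝ) :
    Continuous (fun θ : ℝ => u * (-ccpc u) * exp (-(u * (ρ - θ))) * (1 - exp (-(u * θ)))
        + ccpK u (ρ - θ) * (u * exp (-(u * θ)))) := by
  unfold ccpK
  fun_prop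

/-- `F′(θ) ≥ 0` for `u > 0`, `θ ≥ 0` (both summands non-negative: `c < 0`, `K > 0`, `1 − e^{−uθ} ≥ 0`). -/
theorem bracketF_deriv_nonneg {u : ℝ} (hu : 0 < u) (ρ : ℝ) {θ : ℝ} (hθ : 0 ≤ θ) :
    0 ≤ u * (-ccpc u) * exp (-(u * (ρ - θ))) * (1 - exp (-(u * θ)))
        + ccpK u (ρ - θ) * (u * exp (-(u * θ))) := by
  have hc : 0 ≤ -ccpc u := by linarith [ccpc_neg hu]
  have hφ : 0 ≤ 1 - exp (-(u * θ)) := phi_nonneg hu.le hθ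
  have hK := (ccpK_pos hu (ρ - θ)).le
  positivity

/-! ## `E_Mert` for the walk -/

/-- The room of a state `1 ≤ x ≤ M` is `log((M:ℝ)/x)/log M` and lies in `[0, 1]` (`M ≥ 2`). -/
theorem room_eq_log_div {M x : ℕ} (hM : 2 ≤ M) (hx : 1 ≤ x) :
    room (Real.log M) x = Real.log ((M : ℝ) / x) / Real.log M := by
  have hM' : (0 : ℝ) < M := by exact_mod_cast (by omega : 0 < M)
  have hx' : (0 : ℝ) < x := by exact_mod_cast (by omega : 0 < x)
  have hL : Real.log M ≠ 0 := (Real.log_pos (by exact_mod_cast (by omega : 1 < M))).ne'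
  unfold room
  rw [Real.log_div hM'.ne' hx'.ne']
  field_simp

/-- **16.5 (a) in the kernel, unconditionally.** For `2 ≤ M`, `1 ≤ x ≤ M`, `u > 0`, with `L = log M`,
`ρ = room L x` and `F(θ) = K(u,ρ−θ)(1 − e^{−uθ}) − K(u,ρ)`:
`−8K(u,ρ) ≤ Σ_{q ≤ M/x prime}(log q/q)F(log q/L) − L·I(u,ρ) ≤ 16K(u,ρ)`; dividing by `L`, this is
`−8K/L ≤ E_Mert ≤ 16K/L` (CONTINUUM-LIMIT 16.5 (a) with `(E₂, κ₀) = (4, 2)`). -/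
theorem prime_sum_bracketF_sub_integral_bounds {M x : ℕ} (hM : 2 ≤ M) (hx : 1 ≤ x) (hxM : x ≤ M)
    {u : ℝ} (hu : 0 < u) :
    -(8 * ccpK u (room (Real.log M) x)) ≤
      (∑ q ∈ Nat.primesLE (M / x), Real.log q / q *
          (ccpK u (room (Real.log M) x - Real.log q / Real.log M) * (1 - exp (-(u * (Real.log q / Real.log M))))
            - ccpK u (room (Real.log M) x)))
        - Real.log M * ccpI u (room (Real.log M) x) ∧
    (∑ q ∈ Nat.primesLE (M / x), Real.log q / q *
          (ccpK u (room (Real.log M) x - Real.log q / Real.log M) * (1 - exp (-(u * (Real.log q / Real.log M))))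
            - ccpK u (room (Real.log M) x)))
        - Real.log M * ccpI u (room (Real.log M) x) ≤ 16 * ccpK u (room (Real.log M) x) := by
  set L := Real.log M with hLdef
  set ρ := room L x with hρdef
  have hM1 : (1 : ℝ) < M := by exact_mod_cast (by omega : 1 < M)
  have hL : 0 < L := Real.log_pos hM1
  have hx' : (0 : ℝ) < x := by exact_mod_cast (by omega : 0 < x)
  have hb : (1 : ℝ) ≤ (M : ℝ) / x := by
    rw [le_div_iff₀ hx', one_mul]; exact_mod_cast hxM
  have hρb : Real.log ((M : ℝ) / x) / L = ρ := by rw [hρdef, room_eq_log_div hM hx]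
  have hρ0 : 0 ≤ ρ := by
    rw [← hρb]; exact div_nonneg (Real.log_nonneg hb) hL.le
  have hρ1 : ρ ≤ 1 := by
    rw [hρdef]; unfold room
    have : 0 ≤ Real.log x / L := div_nonneg (Real.log_nonneg (by exact_mod_cast hx)) hL.le
    linarith
  -- the abstract lemma with g = F(·; u, ρ), b = M/x
  have hg := fun θ => hasDerivAt_bracketF hu.ne' ρ θ
  have hlo := le_prime_sum_sub_integral_four hL hg (continuous_bracketF_deriv u ρ) hb
    (fun θ hθ => bracketF_deriv_nonneg hu ρ hθ.1)
  have hhi := prime_sum_sub_integral_le_four hL hg (continuous_bracketF_deriv u ρ) hb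
    (fun θ hθ => bracketF_deriv_nonneg hu ρ hθ.1)
  rw [floor_natCast_div, hρb, integral_ccpK_shift_eq_ccpI hu.ne'] at hlo hhi
  -- sizes of the boundary terms
  have hF0 : ccpK u (ρ - 0) * (1 - exp (-(u * 0))) - ccpK u ρ = -ccpK u ρ := bracketF_zero u ρ
  have habs : |ccpK u (ρ - ρ) * (1 - exp (-(u * ρ))) - ccpK u ρ| ≤ 2 * ccpK u ρ :=
    abs_bracketF_le_two_mul hu hρ0 le_rfl hρ1
  have hdiff : ccpK u (ρ - ρ) * (1 - exp (-(u * ρ))) - ccpK u ρ ≤ ccpK u 0 - ccpK u ρ :=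
    bracketF_le_ccpK_zero_sub hu le_rfl
  have hK0 : ccpK u 0 ≤ 2 * ccpK u ρ := ccpK_zero_le_two_mul_ccpK hu hρ1
  have hKρ := (ccpK_pos hu ρ).le
  rw [hF0] at hhi
  constructor
  · linarith
  · linarith

end Summit.RiemannHypothesis.RiemannHypothesis.Theorems.IntegerScrew

end
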